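import Literature.Analysis.FluidPDE.QuasiSelfSimilarBuildingBlocks
import HarnessLib

/-!
# Compatible building blocks of the Peano snake (Alberti–Crippa–Mazzucato 2019, §8.1–8.6;
Bruè–De Lellis 2023, §4.1)

Topic `Literature/Analysis/FluidPDE` (trunk FluidKinetic, family `turb`). The accepted named fact
`acm_building_blocks` (`QuasiSelfSimilarBuildingBlocks.lean`) packages two different things of
Bruè–De Lellis, CMP 400 (2023), Thm. 4.1: (1) the existence of finitely many building blocks
`(V_i, Θ_i)` with BDL §4.1 (i)–(iv), and (2) the assertion that, once patched by (4.3)–(4.4) on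
the cells of `𝒬(2·5ⁿ)` with suitable labels, they form *smooth* fields on `[0,1] × T²`,
supported per level in the open square, which hand over (`ρ_n(1) = ρ_{n+1}(0)`).

Part (2) is not geometry: in Alberti–Crippa–Mazzucato, JAMS 32 (2019) it is the quasi-self-similar
induction of §6.2 (the label of a square of the next generation is read off the position of the
square inside its parent and the label of the parent — condition (e) of §8.1 and the combinatorial
pattern of §6.5/§8.2, started from four rotated bent channels on the `2 × 2` tiling, Fig. 6),
together with the gluing argument of §8.6–8.8: every block coincides, near the midpoint of each
side crossed by its channel, with *one and the same* field (the canonical field of a straight line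
through the midpoint, §8.4 (c) and Lemma 25), and vanishes near the rest of the boundary of the
square (§8.4 (a)–(b)); adjacent squares always present matching sides (a crossed side faces a
crossed side), so the patched field is smooth across every interface and vanishes near `∂[0,1]²`.

This file isolates the genuinely geometric input as a finer named fact, `acm_compatible_blocks`:
the existence of a **compatible block system** (`QuasiSelfSimilar.IsCompatibleBlockSystem`) —
blocks with BDL §4.1 (i)–(iv) (zero average and unit mass only at `t = 0`; they propagate),
a set of *gates* (crossed sides) for each block, a *child map* (labels of the `25` subsquares at
`t = 1`, ACM §8.1 (e)) and a *seed* (labels of the four squares of `𝒬(2)`, ACM Fig. 6) whose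
gates match across every internal interface and never lie on an outer side, and standard *gate
fields* with which every block agrees near each of its gates while vanishing near the rest of the
boundary (ACM §8.4 (a)–(c), §8.6). From it `acm_building_blocks` — hence the whole family of
BDL Thm. 4.1 — is PROVED (`QuasiSelfSimilarCompatibleBlocksProofs.lean`:
`acm_building_blocks_of_compatible_blocks`), the labels being the explicit recursion
`QuasiSelfSimilar.blockLabel`.

What remains unproved is therefore exactly the kinematics of ACM §8.4–8.5 for the two
time-dependent curves of §8.1 (given in the source by Figures 7–9 only, §8.9–8.11): two smooth
incompressible "moves" of a straight and of a bent channel inside the unit square, agreeing with a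
standard thinning field near the gates, whose final states are the prescribed chains of rescaled
initial states.

## Lean rendering

* Faces of `[0,1]²` are indexed by an axis `k : Fin 2` and a side `s : Bool`
  (`faceValue s ∈ {0, 1}`); `faceMidpoint k s` is the midpoint of the face `{z_k = faceValue s}`.
* `gate i k s : Prop` — the channel of block `i` crosses the face `(k, s)`;
  `child i p : Fin N` — the label of the subsquare `p ∈ {0,…,4}²` of block `i` at `t = 1`;
  `seed q : Fin N` — the label of the square `q ∈ {0,1}²` of `𝒬(2)` at level `0`.
* Gate fields `Vg k, Θg k : ℝ → ℝ² → ·` (one per axis), functions of the offset from the face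
  midpoint; the SAME field serves the two sides `s = false, true` (this is what makes the blocks of
  two adjacent cells restrictions of one smooth function near the common side, ACM §8.6), inside
  the window `|z_j - 1/2| < 2δ` along the face and the strip `|z_k - faceValue s| < δ` across it;
  outside the window (`|z_j - 1/2| ≥ δ`) and near gate-free faces the block vanishes on the strip.
  These clauses are required for all `t ∈ ℝ` and all `z ∈ ℝ²` in the strip (blocks are global
  smooth fields, flat in time outside `[0,1]`, ACM §8.8).
* Gate consistency of the child map (ACM §8.1 (e) with (a)–(b)): horizontally/vertically adjacent
  subsquares have matching gates on their common side; a subsquare on the boundary of the parent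
  has a gate on the outer side iff it is the middle subsquare of that side and the parent has the
  gate there. Seed (ACM Fig. 6): the four level-`0` squares match internally and have no gate on
  `∂[0,1]²`.

## References

* G. Alberti, G. Crippa, A. L. Mazzucato, *Exponential self-similar mixing by incompressible
  flows*, J. Amer. Math. Soc. 32 (2019), 445–490: Ass. 6.1, §6.2, §6.5 (Fig. 6), §8.1 (a)–(e),
  §8.4 (a)–(c), §8.5, §8.6–8.8, §8.9–8.11 (arXiv:1605.02090, pp. 18–28).
* E. Bruè, C. De Lellis, *Anomalous dissipation for the forced 3D Navier–Stokes equations*,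
  Comm. Math. Phys. 400 (2023), 1507–1533, §4.1 (i)–(iv), Thm. 4.1, (4.3)–(4.4).
-/

noncomputable section

open MeasureTheory Set Filter Function

open scoped ContDiff

namespace Literature.Analysis.FluidPDE

namespace QuasiSelfSimilar

open FunctionSpaces FunctionSpaces.Torus

/-! ## Faces of the unit square -/

/-- The coordinate value of a side: `false ↦ 0` (the face `{z_k = 0}`), `true ↦ 1`
(the face `{z_k = 1}`). [folklore] -/
def faceValue (s : Bool) : ℝ := if s then 1 else 0

/-- `faceValue false = 0`. [folklore] -/
@[simp] theorem faceValue_false : faceValue false = 0 := rfl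

/-- `faceValue true = 1`. [folklore] -/
@[simp] theorem faceValue_true : faceValue true = 1 := rfl

/-- The midpoint of the face `{z_k = faceValue s}` of the unit square `[0,1]²`: coordinate `k`
equal to `faceValue s`, the other coordinate equal to `1/2` (ACM 2019, §8.1 (a): the channels
cross the sides of `Q` at their midpoints). [cite: AlbertiCrippaMazzucato2019, §8.1 (a)] -/
def faceMidpoint (k : Fin 2) (s : Bool) : EuclideanSpace ℝ (Fin 2) :=
  WithLp.toLp 2 fun j => if j = k then faceValue s else 2⁻¹

/-- Coordinates of the face midpoint. [folklore] -/
theorem faceMidpoint_apply (k : Fin 2) (s : Bool) (j : Fin 2) :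
    faceMidpoint k s j = if j = k then faceValue s else 2⁻¹ := rfl

/-- The two midpoints of opposite faces differ by the unit lattice vector:
`mid(k, true) = mid(k, false) + e_k`. [folklore] -/
theorem faceMidpoint_true (k : Fin 2) :
    faceMidpoint k true = faceMidpoint k false + latticeVec (Pi.single k 1) := by
  ext j
  rw [PiLp.add_apply, faceMidpoint_apply, faceMidpoint_apply, latticeVec_apply]
  by_cases h : j = k
  · subst h; simp
  · simp [h]

/-! ## Compatible block systems -/

/-- **Compatible block system** (Alberti–Crippa–Mazzucato 2019, §8.1, §8.4 (a)–(c), §8.5–8.6;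
Bruè–De Lellis 2023, §4.1 (i)–(iv)). Data: `N` blocks `(V_i, Θ_i)` (time first, global smooth
fields on `ℝ × ℝ²`), gates `gate i k s` (the channel of block `i` crosses the face
`{z_k = faceValue s}`), a child map `child i p` (label of the subsquare `p/5 + [0,1/5)²` of block
`i` at time `1`), a seed `seed q` (label of the square `q/2 + [0,1/2)²` at level `0`), gate
fields `Vg k, Θg k` (per axis `k`, functions of the offset from the face midpoint) and a margin
`δ`. Conditions:
* (blocks, BDL §4.1 (i)–(iii), ACM §8.4–8.5) smooth; on `[0,1] × [0,1]²` divergence free,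
  tangent to the boundary, transporting `Θ_i`; `|Θ_i| ≤ 10` there; at `t = 0`, `Θ_i` has zero
  average and unit `L²` mass on the square (for later times these follow, ACM Rem. 24 (iv));
* (self-similarity, BDL §4.1 (iv), ACM §8.1 (e)) `Θ_i(1, z) = Θ_{child i p}(0, 5z - p)` on the
  open subsquares;
* (boundary structure, ACM §8.4 (a)–(c), §8.6) on the strip `|z_k - faceValue s| < δ` along the
  face `(k,s)`: the block vanishes if the face is not a gate or if `|z_j - 1/2| ≥ δ` (`j ≠ k`), and
  equals the gate field `(Vg k, Θg k)(t, z - faceMidpoint k s)` if the face is a gate and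
  `|z_j - 1/2| < 2δ` — for all `t ∈ ℝ`, `z ∈ ℝ²`;
* (combinatorics, ACM §8.1 (a),(b),(e), §6.5 Fig. 6) children adjacent inside the parent have
  matching gates on the common side; a child on the parent's boundary has a gate on the outer
  side iff it sits at the middle of that side and the parent has that gate; the four seed squares
  match across the internal sides of `𝒬(2)` and have no gate on `∂[0,1]²`.
[cite: AlbertiCrippaMazzucato2019, §8.1, §8.4 (a)–(c), §8.6] [cite: BrueDeLellisCMP2023, §4.1 (i)–(iv)] -/
structure IsCompatibleBlockSystem {N : ℕ}
    (V : Fin N → ℝ → EuclideanSpace ℝ (Fin 2) → EuclideanSpace ℝ (Fin 2))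
    (Θ : Fin N → ℝ → EuclideanSpace ℝ (Fin 2) → ℝ)
    (gate : Fin N → Fin 2 → Bool → Prop) (child : Fin N → (Fin 2 → Fin 5) → Fin N)
    (seed : (Fin 2 → Fin 2) → Fin N)
    (Vg : Fin 2 → ℝ → EuclideanSpace ℝ (Fin 2) → EuclideanSpace ℝ (Fin 2))
    (Θg : Fin 2 → ℝ → EuclideanSpace ℝ (Fin 2) → ℝ) (δ : ℝ) : Prop where
  /-- The margin is positive … -/
  δ_pos : 0 < δ
  /-- … and small (gate windows `|z_j - 1/2| < 2δ` stay away from the corners). -/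
  δ_le : δ ≤ 8⁻¹
  /-- (i) `V_i ∈ C^∞(ℝ × ℝ²)`. -/
  smooth_velocity : ∀ i, ContDiff ℝ ∞ (uncurry (V i))
  /-- (ii) `Θ_i ∈ C^∞(ℝ × ℝ²)`. -/
  smooth_scalar : ∀ i, ContDiff ℝ ∞ (uncurry (Θ i))
  /-- (i) `div V_i(t) = 0` on `[0,1] × [0,1]²`. -/
  divFree : ∀ i, ∀ t ∈ Icc (0 : ℝ) 1, ∀ z ∈ closedSquare,
    ∑ j, fderiv ℝ (V i t) z (EuclideanSpace.single j 1) j = 0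
  /-- (i) `V_i(t)` is tangent to `∂[0,1]²` (vanishing normal component on the faces). -/
  tangent : ∀ i, ∀ t ∈ Icc (0 : ℝ) 1, ∀ z ∈ closedSquare, ∀ j, (z j = 0 ∨ z j = 1) → V i t z j = 0
  /-- (iii) transport `∂ₜΘ_i + DΘ_i[V_i] = 0` on `[0,1] × [0,1]²`. -/
  transport : ∀ i, ∀ t ∈ Icc (0 : ℝ) 1, ∀ z ∈ closedSquare,
    deriv (fun s => Θ i s z) t + fderiv ℝ (Θ i t) z (V i t z) = 0
  /-- (ii) at `t = 0`: zero average on the square. -/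
  zeroMean_zero : ∀ i, ∫ z in unitCube (Fin 2), Θ i 0 z = 0
  /-- (ii) at `t = 0`: unit `L²` mass on the square (ACM §8.3 (c'): equal lengths). -/
  unitL2_zero : ∀ i, ∫ z in unitCube (Fin 2), Θ i 0 z ^ 2 = 1
  /-- BDL Thm. 4.1 (b) blockwise: `|Θ_i| ≤ 10` on `[0,1] × [0,1]²`. -/
  abs_le : ∀ i, ∀ t ∈ Icc (0 : ℝ) 1, ∀ z ∈ closedSquare, |Θ i t z| ≤ 10
  /-- (iv) self-similarity with the child labels (ACM §8.1 (e)). -/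
  selfSimilar : ∀ i (p : Fin 2 → Fin 5), ∀ z ∈ latticeCellInterior 5 (fun k => ((p k : ℕ) : ℤ)),
    Θ i 1 z = Θ (child i p) 0 ((5 : ℝ) • z - latticeVec fun k => ((p k : ℕ) : ℤ))
  /-- Vanishing on the boundary strips away from the gate windows (ACM §8.4 (a)–(b)). -/
  vanish : ∀ i (t : ℝ) (z : EuclideanSpace ℝ (Fin 2)) (k : Fin 2) (s : Bool),
    |z k - faceValue s| < δ → (¬ gate i k s ∨ ∃ j, j ≠ k ∧ δ ≤ |z j - 2⁻¹|) →
      V i t z = 0 ∧ Θ i t z = 0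
  /-- Agreement with the gate field inside the gate windows (ACM §8.4 (c), §8.6, Lemma 25). -/
  eq_gate : ∀ i (t : ℝ) (z : EuclideanSpace ℝ (Fin 2)) (k : Fin 2) (s : Bool),
    gate i k s → |z k - faceValue s| < δ → (∀ j, j ≠ k → |z j - 2⁻¹| < 2 * δ) →
      V i t z = Vg k t (z - faceMidpoint k s) ∧ Θ i t z = Θg k t (z - faceMidpoint k s)
  /-- Children adjacent inside the parent have matching gates (ACM §8.1 (e)). -/
  child_internal : ∀ i (p : Fin 2 → Fin 5) (k : Fin 2) (h : (p k : ℕ) + 1 < 5),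
    gate (child i p) k true ↔ gate (child i (update p k ⟨(p k : ℕ) + 1, h⟩)) k false
  /-- Gates of children on the upper sides of the parent (ACM §8.1 (a),(b),(e)). -/
  child_boundary_hi : ∀ i (p : Fin 2 → Fin 5) (k : Fin 2), (p k : ℕ) = 4 →
    (gate (child i p) k true ↔ (gate i k true ∧ ∀ j, j ≠ k → (p j : ℕ) = 2))
  /-- Gates of children on the lower sides of the parent (ACM §8.1 (a),(b),(e)). -/
  child_boundary_lo : ∀ i (p : Fin 2 → Fin 5) (k : Fin 2), (p k : ℕ) = 0 →
    (gate (child i p) k false ↔ (gate i k false ∧ ∀ j, j ≠ k → (p j : ℕ) = 2))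
  /-- The seed squares match across the internal sides of `𝒬(2)` (ACM §6.5, Fig. 6). -/
  seed_internal : ∀ (q : Fin 2 → Fin 2) (k : Fin 2) (h : (q k : ℕ) + 1 < 2),
    gate (seed q) k true ↔ gate (seed (update q k ⟨(q k : ℕ) + 1, h⟩)) k false
  /-- No gate on the upper outer sides of `[0,1]²` at level `0` (ACM §6.5, Fig. 6). -/
  seed_boundary_hi : ∀ (q : Fin 2 → Fin 2) (k : Fin 2), (q k : ℕ) = 1 → ¬ gate (seed q) k true
  /-- No gate on the lower outer sides of `[0,1]²` at level `0` (ACM §6.5, Fig. 6). -/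
  seed_boundary_lo : ∀ (q : Fin 2 → Fin 2) (k : Fin 2), (q k : ℕ) = 0 → ¬ gate (seed q) k false

/-! ## The labels of the quasi-self-similar induction -/

/-- The base-`5` digit `κ mod 5 ∈ {0,…,4}²` of a cell index `κ ∈ ℤ²`: the position of the cell
of `𝒬(2·5ⁿ⁺¹)` inside its parent cell of `𝒬(2·5ⁿ)` (ACM 2019, §6.2, iterative step). [cite: AlbertiCrippaMazzucato2019, §6.2] -/
def digit5 (κ : Fin 2 → ℤ) : Fin 2 → Fin 5 := fun k =>
  ⟨(κ k % 5).toNat, by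
    have h0 : 0 ≤ κ k % 5 := Int.emod_nonneg _ (by norm_num)
    have h5 : κ k % 5 < 5 := Int.emod_lt_of_pos _ (by norm_num)
    omega⟩

/-- The parent cell index `⌊κ/5⌋` (ACM 2019, §6.2, iterative step). [cite: AlbertiCrippaMazzucato2019, §6.2] -/
def parent5 (κ : Fin 2 → ℤ) : Fin 2 → ℤ := fun k => κ k / 5

/-- The position `κ mod 2 ∈ {0,1}²` of a cell of `𝒬(2)` (ACM 2019, §6.2, initial step with
`λ̄ = 1/2`, §6.5). [cite: AlbertiCrippaMazzucato2019, §6.2] -/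
def seedIndex (κ : Fin 2 → ℤ) : Fin 2 → Fin 2 := fun k =>
  ⟨(κ k % 2).toNat, by
    have h0 : 0 ≤ κ k % 2 := Int.emod_nonneg _ (by norm_num)
    have h2 : κ k % 2 < 2 := Int.emod_lt_of_pos _ (by norm_num)
    omega⟩

/-- **The labels of the quasi-self-similar construction** (ACM 2019, §6.2; BDL 2023, (4.3): the
index `i(Q)`): at level `0` the cell `κ` of `𝒬(2)` carries the seed label of `κ mod 2`; at level
`n + 1` the cell `κ` of `𝒬(2·5ⁿ⁺¹)` carries the child label, at position `κ mod 5`, of the label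
of its parent `⌊κ/5⌋` at level `n`. Defined for all `κ ∈ ℤ²` (periodically). [cite: AlbertiCrippaMazzucato2019, §6.2] -/
def blockLabel {N : ℕ} (child : Fin N → (Fin 2 → Fin 5) → Fin N) (seed : (Fin 2 → Fin 2) → Fin N) :
    ℕ → (Fin 2 → ℤ) → Fin N
  | 0, κ => seed (seedIndex κ)
  | n + 1, κ => child (blockLabel child seed n (parent5 κ)) (digit5 κ)

/-- Level `0` labels. [folklore] -/
theorem blockLabel_zero {N : ℕ} (child : Fin N → (Fin 2 → Fin 5) → Fin N)
    (seed : (Fin 2 → Fin 2) → Fin N) (κ : Fin 2 → ℤ) :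
    blockLabel child seed 0 κ = seed (seedIndex κ) := rfl

/-- The recursion of the labels. [folklore] -/
theorem blockLabel_succ {N : ℕ} (child : Fin N → (Fin 2 → Fin 5) → Fin N)
    (seed : (Fin 2 → Fin 2) → Fin N) (n : ℕ) (κ : Fin 2 → ℤ) :
    blockLabel child seed (n + 1) κ = child (blockLabel child seed n (parent5 κ)) (digit5 κ) := rfl

end QuasiSelfSimilar

open QuasiSelfSimilar FunctionSpaces

/-- **Compatible building blocks of the Peano snake** (Alberti–Crippa–Mazzucato, JAMS 32 (2019),
§8: the canonical velocity fields and solutions attached to the two time-dependent curves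
`Γ₁, Γ₂` of §8.1 and their rotations/reflections, §8.4 (a)–(c), §8.5, with the interface
structure of §8.6; Bruè–De Lellis, CMP 400 (2023), §4.1 (i)–(iv)): there is a compatible block
system in the sense of `QuasiSelfSimilar.IsCompatibleBlockSystem` — finitely many smooth blocks
`(V_i, Θ_i)`, divergence free, tangent to `∂[0,1]²`, transporting `Θ_i`, with `|Θ_i| ≤ 10`, zero
average and unit mass at `t = 0`, self-similar at `t = 1` through a child map whose gates match
across internal interfaces and reproduce the parent's gates at the middle of the outer sides, a
`2 × 2` seed with matching internal gates and no outer gates, and standard gate fields with which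
every block agrees near its gates while vanishing near the rest of the boundary. The source gives
the two generating curves by figures (§8.9–8.11); everything downstream of this fact
(`acm_building_blocks`, hence BDL Thm. 4.1) is proved from it
(`QuasiSelfSimilarCompatibleBlocksProofs.lean`).
[cite: AlbertiCrippaMazzucato2019, §8.1 (a)–(e), §8.4 (a)–(c), §8.5, §8.6] [cite: BrueDeLellisCMP2023, §4.1 (i)–(iv)] -/
def acm_compatible_blocks : Prop :=
  ∃ (N : ℕ) (V : Fin N → ℝ → EuclideanSpace ℝ (Fin 2) → EuclideanSpace ℝ (Fin 2))
    (Θ : Fin N → ℝ → EuclideanSpace ℝ (Fin 2) → ℝ)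
    (gate : Fin N → Fin 2 → Bool → Prop) (child : Fin N → (Fin 2 → Fin 5) → Fin N)
    (seed : (Fin 2 → Fin 2) → Fin N)
    (Vg : Fin 2 → ℝ → EuclideanSpace ℝ (Fin 2) → EuclideanSpace ℝ (Fin 2))
    (Θg : Fin 2 → ℝ → EuclideanSpace ℝ (Fin 2) → ℝ) (δ : ℝ),
    IsCompatibleBlockSystem V Θ gate child seed Vg Θg δ

end Literature.Analysis.FluidPDE

end
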